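import Summits.BirchSwinnertonDyer.Rank1Residual.TwoVariableGreenbergMainConjectureAnyRoot
import Literature.NumberTheory.EllipticCurves.BurungaleCastellaSkinner2025.OrdinaryGreenbergEquivalence
import HarnessLib

/-!
# BCS Thm. 4.1.3 "In particular, Conjecture 4.1.1 and Conjecture 4.1.2 are equivalent" — PROVED edges
# between the two obligation leaves AT a datum, modulo the ONE refereed named fact
# `thm413_ord_torsion_dvd_iff_greenberg_torsion_dvd` (no torsion hypotheses left)

STAGED by the cross-ladder literature-typing layer (cell `bsd-littype`, seat 03, gen 4; D-0088(4); sheet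
`staging/bsd-littype-03/SHEETS-03.md` §8).  Proof-only companion of
`TwoVariableGreenbergMainConjectureAnyRoot.lean` (the Greenberg leaf `GreenbergTwoVariableMainConjectureAnyRootAt`,
whose §(3) proves BCS Thm. 4.1.3 modulo Yan–Zhu's Thm. 4.7 = `YanZhu2026.thm47_…AnyRoot_…` and must
therefore keep `X_Gr` torsion as a HYPOTHESIS of `of_ordinaryAt` — Thm. 4.7 transports divisibilities,
not torsion-ness; OQ-14 of `OPEN-QUESTIONS-03.md`) and of `TwoVariableOrdinaryMainConjecture.lean` (the
ordinary leaf `OrdinaryTwoVariableMainConjectureAt`).  With BCS Thm. 4.1.3 itself now vendored AS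
PRINTED, torsion clauses included (`BurungaleCastellaSkinner2025/OrdinaryGreenbergEquivalence.lean`:
`thm413_ord_torsion_dvd_iff_greenberg_torsion_dvd`, REFEREED, IMRN 2025), the printed sentence

> "In particular, Conjecture 4.1.1 and Conjecture 4.1.2 are equivalent." (arXiv:2405.00270v2, p. 8,
> `[corpus: paper:arxiv-2405.00270 p0008 L48–L49]`)

becomes a PROVED `iff` between the two leaves at a datum, granted that one fact, the existence of the
Greenberg frame (`YanZhu2026.thm39_def311_exists_isGreenbergLFunctionAnyRoot₂`, for 4.1.1 ⟹ 4.1.2) and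
a type-I frame `F` of `f_E` (for 4.1.2 ⟹ 4.1.1; print: [CGS23, Thm. 1.2.1]), on the locus of the facts
(`YanZhu2026.GreenbergSetting`, (irr_K), `ι₁` compatible with `ι`).  Nothing new is asserted; no
definition; tree vocabulary only.

## References
* [BurungaleCastellaSkinner2025] IMRN 2025 rnaf082 = arXiv:2405.00270v2: Thm. 4.1.3 and "In particular"
  (p. 8), statements 4.1.1 / 4.1.2.
* [YanZhu2024MainConjNonCM] J. Algebra 693 (2026) = arXiv:2412.20078v4: Def. 3.11 / Thm. 3.9 (frame
  existence), Thm. 4.7.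
-/

noncomputable section

open scoped Classical

open PowerSeries NumberField IsDedekindDomain Field CongruenceSubgroup
  Literature.NumberTheory.GaloisRepresentations Literature.NumberTheory.EllipticCurves
  Literature.NumberTheory.EllipticCurves.ModularForms Literature.NumberTheory.EllipticCurves.Rank1Residual
  Literature.NumberTheory.EllipticCurves.IwasawaAlgebra₂ Literature.NumberTheory.EllipticCurves.YanZhu2026
  Literature.NumberTheory.EllipticCurves.BurungaleCastellaSkinner2025

namespace Summit.BirchSwinnertonDyer.Rank1Residual.TwoVariableIMC.GreenbergAnyRoot

variable {p : ℕ} [Fact p.Prime] {K : Type} [Field K] [NumberField K]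
  (ι₁ : integralClosure ℚ ℂ →+* ℂ_[p]) (ι : PadicAlgCl p ≃+* ℂ) (W : WeierstrassCurve ℚ)
  [W.IsElliptic] [W.IsGloballyMinimal] (v vbar : HeightOneSpectrum (𝓞 K)) (κ₁ κ₂ : ZpExtension K p)
  (γ₁ γ₂ : absoluteGaloisGroup K) [Fact (ZpExtension.IsTopGeneratorPair κ₁ κ₂ γ₁ γ₂)] {N : ℕ}
  [NeZero N] (π : ModularParametrizationData W N) [NeZero (NumberField.discr K).natAbs]

/-- **BCS Thm. 4.1.3, (i) ⟹ (ii) in full at a datum, for EVERY Katz/Greenberg frame**: statement 4.1.1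
at `(E, K, p, π, ι₁)` gives, for every frame `(LK, G)` of `f_E` and every compatible `J`, BOTH `X_Gr`
`Λ_K`-torsion AND `ch(X_Gr)·𝒪_{ℂ_p}⟦T₁,T₂⟧ = (G)` — granted the fact, under its hypotheses.
[cite: BurungaleCastellaSkinner2025, Thm. 4.1.3 (§4.1, p. 8 of arXiv:2405.00270v2)] -/
theorem isTorsion_and_charIdeal_map_eq_span_of_ordinaryAt_of_thm413
    (h413 : thm413_ord_torsion_dvd_iff_greenberg_torsion_dvd)
    (hS : GreenbergSetting ι W N K v vbar κ₁ κ₂) (hirrK : (W.baseChange K).HasIrreducibleModPGaloisRep p)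
    (hι : ∀ z : integralClosure ℚ ℂ, ι₁ z = ((ι.symm (z : ℂ) : PadicAlgCl p) : ℂ_[p]))
    (hord : OrdinaryTwoVariableMainConjectureAt ι₁ W K κ₁ κ₂ γ₁ γ₂ π)
    {Ω δ : ℂ} {Ωp : (unrIntegers p)ˣ} {LK G : PowerSeries (PowerSeries (PadicComplexInt p))}
    (hLK : IsKatzMeasure₂ ι v vbar ∅ κ₁ κ₂ γ₁⁻¹ γ₂⁻¹ 1 Ω δ ((Ωp : unrIntegers p) : ℂ_[p]) LK)
    (hG : IsGreenbergLFunctionAnyRoot₂ ι v vbar κ₁ κ₂ γ₁⁻¹ γ₂⁻¹ π.f (NumberField.discr K).natAbs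
      (NumberField.classNumber K) LK G)
    {J : ℤ_[p] →+* PadicComplexInt p}
    (hJ : ∀ x : ℤ_[p], ((J x : PadicComplexInt p) : ℂ_[p]) = ((x : ℚ_[p]) : ℂ_[p])) :
    Module.IsTorsion (IwasawaAlgebra₂ p) ((W.baseChange K).XGr₂ p κ₁ κ₂ vbar γ₁ γ₂) ∧
      (WeierstrassCurve.XGr₂.charIdeal (W.baseChange K) p κ₁ κ₂ vbar γ₁ γ₂).map (toUnr₂ p J) =
        Ideal.span {G} := by
  obtain ⟨F, hF, hc, htor, hle, hge⟩ := hord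
  obtain ⟨h1, h2⟩ := h413 ι₁ ι W K v vbar κ₁ κ₂ γ₁ γ₂ π hS hirrK hι F hF hc Ω δ Ωp LK G hLK hG J hJ 1
    (Or.inl rfl)
  obtain ⟨htorGr, hle'⟩ := h1.mp ⟨htor, hle.away 1⟩
  obtain ⟨-, hge'⟩ := h2.mp ⟨htor, hge.away 1⟩
  rw [map_one, exists_span_one_pow_mul_le_iff] at hle' hge'
  exact ⟨htorGr, le_antisymm hle' hge'⟩

/-- **BCS Thm. 4.1.3, "Conjecture 4.1.1 ⟹ Conjecture 4.1.2" AT a datum, torsion clause DISCHARGED** —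
granted the fact and the existence of the Greenberg frame (`thm39_def311_…AnyRoot₂`), under the facts'
hypotheses: `4.1.1 at (E, K, p, π, ι₁) ⟹ 4.1.2 at (E, K, p, f_E, ι)`.  (Compare
`GreenbergAnyRoot.of_ordinaryAt`, which needs `X_Gr` torsion as a hypothesis.)
[cite: BurungaleCastellaSkinner2025, Thm. 4.1.3 ("In particular, Conjecture 4.1.1 and Conjecture 4.1.2 are equivalent", §4.1, p. 8 of arXiv:2405.00270v2)]
[cite: YanZhu2024MainConjNonCM, Def. 3.11 / Thm. 3.9–3.10 (frame existence, arXiv:2412.20078v4 TeX l.839–878)] -/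
theorem of_ordinaryAt_of_thm413 (h413 : thm413_ord_torsion_dvd_iff_greenberg_torsion_dvd)
    (h39 : thm39_def311_exists_isGreenbergLFunctionAnyRoot₂) (hS : GreenbergSetting ι W N K v vbar κ₁ κ₂)
    (hirrK : (W.baseChange K).HasIrreducibleModPGaloisRep p)
    (hι : ∀ z : integralClosure ℚ ℂ, ι₁ z = ((ι.symm (z : ℂ) : PadicAlgCl p) : ℂ_[p]))
    (hord : OrdinaryTwoVariableMainConjectureAt ι₁ W K κ₁ κ₂ γ₁ γ₂ π) :
    GreenbergTwoVariableMainConjectureAnyRootAt ι W K v vbar κ₁ κ₂ γ₁ γ₂ π.f := by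
  obtain ⟨Ω, δ, Ωp, LK, G, hΩ, hδ, hLK, hG⟩ := h39 ι W K v vbar κ₁ κ₂ γ₁ γ₂ π.isNewformOf hS
  obtain ⟨J₀, hJ₀⟩ := exists_structureMap_padicInt (p := p)
  refine ⟨Ω, δ, Ωp, LK, G, hΩ, hδ, hLK, hG,
    (isTorsion_and_charIdeal_map_eq_span_of_ordinaryAt_of_thm413 ι₁ ι W v vbar κ₁ κ₂ γ₁ γ₂ π h413 hS
      hirrK hι hord hLK hG hJ₀).1, fun J hJ ↦ ?_⟩
  exact (isTorsion_and_charIdeal_map_eq_span_of_ordinaryAt_of_thm413 ι₁ ι W v vbar κ₁ κ₂ γ₁ γ₂ π h413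
    hS hirrK hι hord hLK hG hJ).2

/-- **BCS Thm. 4.1.3, "Conjecture 4.1.2 ⟹ Conjecture 4.1.1" AT a datum, torsion clause DISCHARGED by
the fact itself** (no appeal to `YanZhu2026.cor29_XOrd₂_isTorsion`) — granted the fact and a type-I
frame `F` of `f_E` (print: [CGS23, Thm. 1.2.1]), under the facts' hypotheses:
`4.1.2 at (E, K, p, f_E, ι) ⟹ 4.1.1 at (E, K, p, π, ι₁)`.
[cite: BurungaleCastellaSkinner2025, Thm. 4.1.3 ("In particular, Conjecture 4.1.1 and Conjecture 4.1.2 are equivalent", §4.1, p. 8 of arXiv:2405.00270v2)] -/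
theorem ordinaryAt_of_thm413 (h413 : thm413_ord_torsion_dvd_iff_greenberg_torsion_dvd)
    (hS : GreenbergSetting ι W N K v vbar κ₁ κ₂) (hirrK : (W.baseChange K).HasIrreducibleModPGaloisRep p)
    (hι : ∀ z : integralClosure ℚ ℂ, ι₁ z = ((ι.symm (z : ℂ) : PadicAlgCl p) : ℂ_[p]))
    {F : CycAntiSeries p} (hF : IsHidaRankinLFunction ι₁ W κ₁ κ₂ π.f F) (hc : IsCongruenceIntegral π.f F)
    (hgr : GreenbergTwoVariableMainConjectureAnyRootAt ι W K v vbar κ₁ κ₂ γ₁ γ₂ π.f) :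
    OrdinaryTwoVariableMainConjectureAt ι₁ W K κ₁ κ₂ γ₁ γ₂ π := by
  obtain ⟨Ω, δ, Ωp, LK, G, -, -, hLK, hG, htorGr, hJall⟩ := hgr
  obtain ⟨J, hJ⟩ := exists_structureMap_padicInt (p := p)
  obtain ⟨h1, h2⟩ := h413 ι₁ ι W K v vbar κ₁ κ₂ γ₁ γ₂ π hS hirrK hι F hF hc Ω δ Ωp LK G hLK hG J hJ 1
    (Or.inl rfl)
  have heq := hJall J hJ
  have hle' : ∃ n : ℕ, Ideal.span {toUnr₂ p J 1 ^ n} *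
      (WeierstrassCurve.XGr₂.charIdeal (W.baseChange K) p κ₁ κ₂ vbar γ₁ γ₂).map (toUnr₂ p J) ≤
        Ideal.span {G} := by
    rw [map_one, exists_span_one_pow_mul_le_iff]; exact heq.le
  have hge' : ∃ n : ℕ, Ideal.span {toUnr₂ p J 1 ^ n} * Ideal.span {G} ≤
      (WeierstrassCurve.XGr₂.charIdeal (W.baseChange K) p κ₁ κ₂ vbar γ₁ γ₂).map (toUnr₂ p J) := by
    rw [map_one, exists_span_one_pow_mul_le_iff]; exact heq.ge
  obtain ⟨htor, hle⟩ := h1.mpr ⟨htorGr, hle'⟩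
  obtain ⟨-, hge⟩ := h2.mpr ⟨htorGr, hge'⟩
  exact ⟨F, hF, hc, htor, idealLeSpanAway_one_iff.mp hle, spanLeIdealAway_one_iff.mp hge⟩

/-- **"In particular, Conjecture 4.1.1 and Conjecture 4.1.2 are equivalent" — as a PROVED `iff` between
the two leaves AT a datum**, granted the one refereed fact (BCS Thm. 4.1.3 with torsion clauses), the
Greenberg frame existence `thm39_def311_…AnyRoot₂` and a type-I frame `F` of `f_E`, on the facts' locus:
`4.1.1 at (E, K, p, π, ι₁) ⟺ 4.1.2 at (E, K, p, f_E, ι)`.  No torsion hypothesis on either side.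
[cite: BurungaleCastellaSkinner2025, Thm. 4.1.3 ("In particular, Conjecture 4.1.1 and Conjecture 4.1.2 are equivalent", §4.1, p. 8 of arXiv:2405.00270v2)]
[cite: YanZhu2024MainConjNonCM, Def. 3.11 / Thm. 3.9 (frame existence), Thm. 4.7] -/
theorem ordinaryAt_iff_greenbergAt_of_thm413 (h413 : thm413_ord_torsion_dvd_iff_greenberg_torsion_dvd)
    (h39 : thm39_def311_exists_isGreenbergLFunctionAnyRoot₂) (hS : GreenbergSetting ι W N K v vbar κ₁ κ₂)
    (hirrK : (W.baseChange K).HasIrreducibleModPGaloisRep p)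
    (hι : ∀ z : integralClosure ℚ ℂ, ι₁ z = ((ι.symm (z : ℂ) : PadicAlgCl p) : ℂ_[p]))
    {F : CycAntiSeries p} (hF : IsHidaRankinLFunction ι₁ W κ₁ κ₂ π.f F) (hc : IsCongruenceIntegral π.f F) :
    OrdinaryTwoVariableMainConjectureAt ι₁ W K κ₁ κ₂ γ₁ γ₂ π ↔
      GreenbergTwoVariableMainConjectureAnyRootAt ι W K v vbar κ₁ κ₂ γ₁ γ₂ π.f :=
  ⟨of_ordinaryAt_of_thm413 ι₁ ι W v vbar κ₁ κ₂ γ₁ γ₂ π h413 h39 hS hirrK hι,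
    ordinaryAt_of_thm413 ι₁ ι W v vbar κ₁ κ₂ γ₁ γ₂ π h413 hS hirrK hι hF hc⟩

/-- **The two printed SENTENCES are equivalent on the facts' locus** (where a type-I frame and the
Greenberg frame exist): granted the fact, `bcs2025_statement_4_1_1` restricted to data carrying
`GreenbergSetting` + (irr_K) + a compatible `ι₁` implies `GreenbergTwoVariableMainConjectureAnyRootAt`
there — the sentence-level form of "4.1.1 ⟹ 4.1.2" used by planners (`--conditional-on` either leaf).
[cite: BurungaleCastellaSkinner2025, Thm. 4.1.3 ("In particular", §4.1, p. 8 of arXiv:2405.00270v2)] -/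
theorem of_statement_4_1_1_of_thm413 (h413 : thm413_ord_torsion_dvd_iff_greenberg_torsion_dvd)
    (h39 : thm39_def311_exists_isGreenbergLFunctionAnyRoot₂) (h411 : bcs2025_statement_4_1_1)
    (hS : GreenbergSetting ι W N K v vbar κ₁ κ₂) (hirrK : (W.baseChange K).HasIrreducibleModPGaloisRep p)
    (hι : ∀ z : integralClosure ℚ ℂ, ι₁ z = ((ι.symm (z : ℂ) : PadicAlgCl p) : ℂ_[p])) :
    GreenbergTwoVariableMainConjectureAnyRootAt ι W K v vbar κ₁ κ₂ γ₁ γ₂ π.f :=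
  of_ordinaryAt_of_thm413 ι₁ ι W v vbar κ₁ κ₂ γ₁ γ₂ π h413 h39 hS hirrK hι
    (Summit.BirchSwinnertonDyer.Rank1Residual.TwoVariableIMC.at_of_statement h411 ι₁ W κ₁ κ₂ γ₁ γ₂ π
      hS.three_le hS.goodOrd hS.isImaginaryQuadratic hS.split hS.coprime hirrK)

end Summit.BirchSwinnertonDyer.Rank1Residual.TwoVariableIMC.GreenbergAnyRoot

end
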